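import Summits.AnomalousDissipation.AnomalousDissipation.Theorems.BaireTransferDenseLoudDesignerForcesHomoclinicEngine
import Literature.Analysis.FunctionSpaces.TorusClassicalNSConcatenation
import Literature.Analysis.FunctionSpaces.TorusH1DistanceBounds
import Literature.Dynamics.Hyperbolic.TransitTimeSchedules

/-!
# Stub `stub_trainOfPeriodicShadow` (ENGINE layer D2′, the gluing step) of the line
# `homoclinic-excursion-trains` (crux stmt-AnomalousDissipation-1143, `BaireTransfer.DenseLoudDesignerForces`)

Proves the registered stub `stub_trainOfPeriodicShadow` over the vocabulary of
`Theorems/BaireTransferDenseLoudDesignerForcesHomoclinicEngine.lean` (`SectionPackage`, `pseudoOrbit`, `period`)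
and `…HomoclinicLine.lean` (`IsTrain`, `h1DistSq`): a `period`-periodic orbit `x` of the polysection map
`ε`-shadowing the one-loop pseudo-orbit `…, q₋N, …, q_N, p₀ (m times), …`, with the two-sided geometric
deviation bounds supplied by hyperbolic tracking (hypotheses), yields a ONE-LOOP TRAIN of `u_Γ` for
`ε ≤ ε₁(δ)`, `N ≥ N₀(ε)`, `m ≥ m₀(N, ℓ)`.  Order of the proof: package constants; `ε₁` (five smallness
conditions at `ε → 0`); `N₀` (tail conditions `θ^{N−n₀} → 0`); `m₀` (the period `Σ_{k<M} ret (x k) ≥ m·ret p₀/2`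
dominates `ℓ + 2|tq(−N)| + 2|tq(N+1)| + ret p₀ + 1`); the schedule and its drifts
(`Literature.Dynamics.Hyperbolic.TransitTimeSchedules`); concatenation + periodic closing of the local classical
solutions (`Literature.Analysis.FunctionSpaces.TorusClassicalNSConcatenation`); equal-time closeness on
`[−d/2, ℓ + d/2]` by the parallelogram bounds of `TorusH1DistanceBounds`, in the concatenation window through the
crossings `q_{k−N}` (excursion) or through `u_P` (dwell), and before the anchor `tq(−N)` by reading the train one
period later, against the backward tail of `u_Γ`.
-/

-- `Summit.<Summit>.<Problem>` is the tree's mandated summit-side namespace (CONVENTIONS §2); for this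
-- single-conjunct summit the two coincide, so the duplicate is deliberate.
set_option linter.dupNamespace false

noncomputable section

open scoped BigOperators Topology
open Filter Set Function TopologicalSpace MeasureTheory Metric

namespace Summit.AnomalousDissipation.AnomalousDissipation.Theorems.DenseLoudDesignerForces.Homoclinic

open Literature.Analysis.FunctionSpaces Literature.Analysis.FunctionSpaces.Torus
open Literature.Analysis.FluidPDE
open Summit.AnomalousDissipation.AnomalousDissipation.Theses.BaireTransfer
open Summit.AnomalousDissipation.AnomalousDissipation.Theorems.DenseLoudDesignerForces.Negative
open Literature.Dynamics.Hyperbolic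

/-- The flat unit torus `T³`. -/
local notation "𝕋³" => UnitAddTorus (Fin 3)
/-- Real velocity values. -/
local notation "ℝ³" => EuclideanSpace ℝ (Fin 3)

-- The proof is one long bookkeeping argument over a single shared context (package constants, the
-- orbit, its schedule); its elaboration exceeds the default heartbeat budget of ONE declaration.
set_option maxHeartbeats 400000 in
/-- **D2′ — a periodic polysection orbit shadowing the one-loop pseudo-orbit with two-sided geometric decay
is a one-loop train** (registered stub of the line `homoclinic-excursion-trains`, ENGINE layer, gluing
step): glue the local solutions `pkg.sol (x k)` along the transit schedule `T (k+1) = T k + ret (x k)`,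
`T 0 = tq (−N)` (`Torus.IsClassicalNSSolutionOn.concat_schedule`), close up by the periodicity of `x`
(`periodic_extension`), take `d := Σ_{k<M} ret (x k) − ℓ`, and compare with `u_Γ` at EQUAL TIMES: along the
excursion through `sol (q n)` (continuous dependence + schedule drift `O(ε)` + time-Lipschitz bound of `u_Γ`),
near the base through `u_P` (the train's dwell and both tails of `u_Γ` are phase-locked to `tq (∓N)` modulo
`ret p₀`, up to `O(ε) + O(θ^{N−n₀})`). [folklore] -/
theorem stub_trainOfPeriodicShadow {ν : ℝ} {F : 𝕋³ → ℝ³} {uP : ℝ → 𝕋³ → ℝ³} {τP : ℝ} {uΓ : ℝ → 𝕋³ → ℝ³}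
    (pkg : SectionPackage ν F uP τP uΓ) (hν : 0 < ν) (hloop : IsHomoclinicLoop ν F uP τP uΓ)
    {ℓ : ℝ} (hℓ : 0 ≤ ℓ) {δ : ℝ} (hδ : 0 < δ) {C θ Cq : ℝ} {n₀ : ℕ} (hC : 0 < C) (hθ : 0 < θ) (hθ1 : θ < 1)
    (hCq : 0 ≤ Cq)
    (hq : ∀ n : ℕ, n₀ ≤ n → ‖pkg.q n - pkg.p₀‖ ≤ Cq * θ ^ (n - n₀) ∧ ‖pkg.q (-(n : ℤ)) - pkg.p₀‖ ≤ Cq * θ ^ (n - n₀)) :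
    ∃ ε₁ : ℝ, 0 < ε₁ ∧ ∀ ε : ℝ, 0 < ε → ε ≤ ε₁ → ∃ N₀ : ℕ, ∀ Nc : ℕ, N₀ ≤ Nc → ∃ m₀ : ℕ, ∀ m : ℕ, m₀ ≤ m →
      ∀ x : ℤ → Sec, IsOrbit pkg.ψ x → (∀ k, x (k + SectionPackage.period Nc m) = x k) →
        Shadows ε x (pkg.pseudoOrbit Nc m) →
        (∀ i : ℕ, i ≤ 2 * Nc → ‖x i - pkg.q ((i : ℤ) - Nc)‖ ≤ C * ε * (θ ^ i + θ ^ (2 * Nc - i))) →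
        (∀ i : ℕ, i < m → ‖x ((2 * Nc + 1 + i : ℕ) : ℤ) - pkg.p₀‖ ≤ C * ε * (θ ^ i + θ ^ (m - 1 - i))) →
          ∃ d : ℝ, 0 ≤ d ∧ ∃ (u : ℝ → 𝕋³ → ℝ³) (p : ℝ → 𝕋³ → ℝ), IsTrain ν F uΓ ℓ δ d u p := by
  classical
  /- §0 constants of the package (`K`, `Kt` made non-negative) -/
  obtain ⟨L, hL⟩ := pkg.ret_lipschitz
  obtain ⟨K₀, hK₀⟩ := pkg.sol_lipschitz
  obtain ⟨Kt₀, hKt₀⟩ := pkg.time_lipschitz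
  set S : Set Sec := cthickening pkg.r pkg.loop
  set r : ℝ := pkg.r
  set P₀ : ℝ := pkg.ret pkg.p₀
  have hr : 0 < r := pkg.r_pos
  have hP₀ : 0 < P₀ := pkg.ret_p₀_pos
  have hp₀S : pkg.p₀ ∈ S := self_subset_cthickening _ pkg.p₀_mem_loop
  have hqS : ∀ n, pkg.q n ∈ S := fun n => self_subset_cthickening _ (pkg.q_mem_loop n)
  set K : ℝ := max K₀ 0
  set Kt : ℝ := max Kt₀ 0
  have hK0 : 0 ≤ K := le_max_right _ _
  have hKt0 : 0 ≤ Kt := le_max_right _ _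
  have hmax : ∀ {a K' b : ℝ}, a ≤ K' * b ^ 2 → a ≤ max K' 0 * b ^ 2 := fun h =>
    h.trans (mul_le_mul_of_nonneg_right (le_max_left _ _) (sq_nonneg _))
  have hK : ∀ s ∈ S, ∀ s' ∈ ball s r, ∀ t ∈ Ioc 0 (pkg.ret s + r),
      h1DistSq (pkg.sol s t) (pkg.sol s' t) ≤ K * ‖s - s'‖ ^ 2 := fun s hs s' hs' t ht => hmax (hK₀ s hs s' hs' t ht)
  have hKt : ∀ t t', h1DistSq (uΓ t) (uΓ t') ≤ Kt * (t - t') ^ 2 ∧ h1DistSq (uP t) (uP t') ≤ Kt * (t - t') ^ 2 :=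
    fun t t' => ⟨hmax (hKt₀ t t').1, hmax (hKt₀ t t').2⟩
  have hθ' : 0 < 1 - θ := by linarith
  have hL0 : (0 : ℝ) ≤ L := L.2
  have hθpow : ∀ {a b : ℕ}, a ≤ b → θ ^ b ≤ θ ^ a := fun hab => pow_le_pow_of_le_one hθ.le hθ1.le hab
  have hθle1 : ∀ a : ℕ, θ ^ a ≤ 1 := fun a => pow_le_one₀ hθ.le hθ1.le
  /- §1 the accuracy `ε₁`: finitely many smallness conditions as `ε → 0` -/
  obtain ⟨ε₁, hε₁, hε₁P⟩ : ∃ ε₁ : ℝ, 0 < ε₁ ∧ ∀ ε : ℝ, 0 < ε → ε ≤ ε₁ →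
      ε ≤ r ∧ 2 * C * ε ≤ r / 2 ∧ (L : ℝ) * (C * ε * (2 / (1 - θ))) ≤ min r P₀ / 8 ∧
        K * (2 * C * ε) ^ 2 ≤ δ ^ 2 / 16 ∧ Kt * ((L : ℝ) * (C * ε * (2 / (1 - θ)))) ^ 2 ≤ δ ^ 2 / 256 := by
    have c1 : ∀ᶠ ε : ℝ in 𝓝 0, ε ≤ r := tendsto_id.eventually_le_const hr
    have c2 : ∀ᶠ ε : ℝ in 𝓝 0, 2 * C * ε ≤ r / 2 :=
      ((by fun_prop : Continuous fun ε : ℝ => 2 * C * ε).tendsto' 0 0 (by simp)).eventually_le_const (by positivity)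
    have c3 : ∀ᶠ ε : ℝ in 𝓝 0, (L : ℝ) * (C * ε * (2 / (1 - θ))) ≤ min r P₀ / 8 :=
      ((by fun_prop : Continuous fun ε : ℝ => (L : ℝ) * (C * ε * (2 / (1 - θ)))).tendsto' 0 0
        (by simp)).eventually_le_const (by positivity)
    have c4 : ∀ᶠ ε : ℝ in 𝓝 0, K * (2 * C * ε) ^ 2 ≤ δ ^ 2 / 16 :=
      ((by fun_prop : Continuous fun ε : ℝ => K * (2 * C * ε) ^ 2).tendsto' 0 0
        (by simp)).eventually_le_const (by positivity)
    have c5 : ∀ᶠ ε : ℝ in 𝓝 0, Kt * ((L : ℝ) * (C * ε * (2 / (1 - θ)))) ^ 2 ≤ δ ^ 2 / 256 :=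
      ((by fun_prop : Continuous fun ε : ℝ => Kt * ((L : ℝ) * (C * ε * (2 / (1 - θ)))) ^ 2).tendsto'
        0 0 (by simp)).eventually_le_const (by positivity)
    obtain ⟨ε₀, hε₀, h⟩ := Metric.eventually_nhds_iff.1 (c1.and (c2.and (c3.and (c4.and c5))))
    exact ⟨ε₀ / 2, by positivity, fun ε hε hεε =>
      h (by rw [Real.dist_eq, sub_zero, abs_of_pos hε]; linarith)⟩
  refine ⟨ε₁, hε₁, fun ε hε hεε₁ => ?_⟩
  obtain ⟨hεr, hCεr, hEc, hKε, hKtE⟩ := hε₁P ε hε hεε₁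
  set E : ℝ := (L : ℝ) * (C * ε * (2 / (1 - θ))) with hE_def
  have hE0 : 0 ≤ E := by positivity
  /- §2 the cut `N₀`: tail smallness conditions as `N → ∞` -/
  obtain ⟨N₀, hN₀P⟩ : ∃ N₀ : ℕ, ∀ Nc : ℕ, N₀ ≤ Nc → n₀ ≤ Nc ∧ Cq * θ ^ (Nc - n₀) ≤ r / 2 ∧
      (L : ℝ) * (Cq * θ ^ (Nc - n₀)) ≤ min r P₀ / 4 ∧ K * Cq ^ 2 * θ ^ (Nc - n₀) ≤ δ ^ 2 / 16 ∧
        Kt * ((L : ℝ) * Cq / (1 - θ)) ^ 2 * θ ^ (Nc - n₀) ≤ δ ^ 2 / 256 := by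
    have c3 : ∀ᶠ Nc : ℕ in atTop, (L : ℝ) * (Cq * θ ^ (Nc - n₀)) ≤ min r P₀ / 4 := by
      filter_upwards [eventually_mul_pow_sub_le hθ.le hθ1 ((L : ℝ) * Cq) (b := min r P₀ / 4)
        (by positivity) n₀] with Nc hNc
      linarith [mul_assoc (L : ℝ) Cq (θ ^ (Nc - n₀))]
    exact eventually_atTop.1 ((eventually_ge_atTop n₀).and ((eventually_mul_pow_sub_le hθ.le hθ1 Cq
      (by positivity) n₀).and (c3.and ((eventually_mul_pow_sub_le hθ.le hθ1 _ (by positivity) n₀).and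
        (eventually_mul_pow_sub_le hθ.le hθ1 _ (by positivity) n₀)))))
  refine ⟨N₀, fun Nc hNc => ?_⟩
  obtain ⟨hn₀Nc, hQr, hLQ, hKQ, hKtB⟩ := hN₀P Nc hNc
  set Q : ℝ := Cq * θ ^ (Nc - n₀) with hQ_def
  set B : ℝ := (L : ℝ) * (Cq * (θ ^ (Nc - n₀) / (1 - θ))) with hB_def
  have hB0 : 0 ≤ B := by positivity
  have hqfw : ∀ n : ℕ, ‖pkg.q ((Nc : ℤ) + n) - pkg.p₀‖ ≤ Cq * θ ^ (Nc - n₀ + n) := fun n => by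
    have h := (hq (Nc + n) (by omega)).1
    rw [show Nc + n - n₀ = Nc - n₀ + n by omega] at h
    exact_mod_cast h
  have hqbw : ∀ n : ℕ, ‖pkg.q (-(Nc : ℤ) - 1 - n) - pkg.p₀‖ ≤ Cq * θ ^ (Nc - n₀ + n) := fun n => by
    have h := (hq (Nc + 1 + n) (by omega)).2
    rw [show (-((Nc + 1 + n : ℕ) : ℤ)) = -(Nc : ℤ) - 1 - n by push_cast; ring] at h
    exact h.trans (mul_le_mul_of_nonneg_left (hθpow (by omega)) hCq)
  have hdriftfw : ∀ n : ℕ, |pkg.tq ((Nc : ℤ) + n) - pkg.tq Nc - n * P₀| ≤ B := fun n => by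
    rw [eq_add_sum_of_succ_eq_add pkg.tq_succ (Nc : ℤ) n, add_sub_cancel_left]
    exact abs_sum_sub_mul_le_of_norm_sub_le_geometric hL (fun j => hqS _) hp₀S hCq hθ.le hθ1 hqfw n
  have hdriftbw : ∀ n : ℕ, |pkg.tq (-(Nc : ℤ)) - pkg.tq (-(Nc : ℤ) - n) - n * P₀| ≤ B := fun n => by
    rw [sub_eq_sum_of_succ_eq_add pkg.tq_succ (-(Nc : ℤ)) n]
    exact abs_sum_sub_mul_le_of_norm_sub_le_geometric hL (fun j => hqS _) hp₀S hCq hθ.le hθ1 hqbw n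
  have hretq : |pkg.ret (pkg.q Nc) - P₀| ≤ (L : ℝ) * Q := by
    have h := hL.dist_le_mul _ (hqS Nc) _ hp₀S
    rw [Real.dist_eq, dist_eq_norm] at h
    exact h.trans (mul_le_mul_of_nonneg_left (by simpa using hqfw 0) hL0)
  /- §3 the dwell length `m₀`: the period must dominate the window bookkeeping -/
  set Q₀ : ℝ := ℓ + 2 * |pkg.tq (-(Nc : ℤ))| + 2 * |pkg.tq ((Nc : ℤ) + 1)| + P₀ + 1 with hQ₀_def
  obtain ⟨m₀, hm₀⟩ := exists_nat_ge (Q₀ / (P₀ / 2))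
  refine ⟨m₀, fun m hm x hx hper hsh hexc hdw => ?_⟩
  have hmP : Q₀ ≤ m * (P₀ / 2) := by
    rw [div_le_iff₀ (by positivity)] at hm₀
    exact hm₀.trans (mul_le_mul_of_nonneg_right (by exact_mod_cast hm) (by positivity))
  /- §4 the orbit: membership, deviations, transit times -/
  set M : ℕ := 2 * Nc + 1 + m with hM_def
  have hxS : ∀ k : ℤ, x k ∈ S := fun k =>
    mem_cthickening_of_dist_le (x k) (pkg.pseudoOrbit Nc m k) pkg.r pkg.loop (pkg.pseudoOrbit_mem_loop Nc m k)
      (by rw [dist_eq_norm]; exact (hsh k).trans hεr)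
  have hxM : ∀ j : ℕ, x ((j + M : ℕ) : ℤ) = x j := fun j => by
    have h := hper j; unfold SectionPackage.period at h; push_cast [hM_def] at h ⊢; exact h
  have hCε2 : ∀ a b : ℕ, C * ε * (θ ^ a + θ ^ b) ≤ 2 * C * ε := fun a b =>
    calc C * ε * (θ ^ a + θ ^ b) ≤ C * ε * 2 :=
          mul_le_mul_of_nonneg_left (by linarith [hθle1 a, hθle1 b]) (by positivity)
      _ = 2 * C * ε := by ring
  have hdw' : ∀ i : ℕ, i < m → ‖x ((2 * Nc + 1 + i : ℕ) : ℤ) - pkg.p₀‖ ≤ 2 * C * ε := fun i hi =>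
    (hdw i hi).trans (hCε2 _ _)
  have hret_pos : ∀ k : ℕ, 0 < pkg.ret (x k) := fun k => pkg.ret_pos _ (hxS k)
  have hret_near : ∀ (k : ℕ) (s : Sec), s ∈ S → ‖x k - s‖ ≤ 2 * C * ε →
      |pkg.ret (x k) - pkg.ret s| ≤ min r P₀ / 8 := fun k s hs hks => by
    have h := hL.dist_le_mul _ (hxS k) _ hs
    rw [Real.dist_eq, dist_eq_norm] at h
    refine h.trans ((mul_le_mul_of_nonneg_left hks hL0).trans ((mul_le_mul_of_nonneg_left ?_ hL0).trans hEc))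
    have h2 : (2 : ℝ) ≤ 2 / (1 - θ) := by rw [le_div_iff₀ hθ']; linarith only [hθ.le, hθ']
    linarith only [mul_le_mul_of_nonneg_left h2 (mul_nonneg hC.le hε.le)]
  /- §5 the schedule -/
  set T : ℕ → ℝ := fun k => pkg.tq (-(Nc : ℤ)) + ∑ j ∈ Finset.range k, pkg.ret (x j) with hT_def
  have hT_succ : ∀ k, T (k + 1) = T k + pkg.ret (x k) := fun k => by
    simp only [hT_def, Finset.sum_range_succ]; ring
  have hT0 : T 0 = pkg.tq (-(Nc : ℤ)) := by simp [hT_def]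
  have hTmono : StrictMono T := strictMono_nat_of_lt_succ fun k => by rw [hT_succ]; linarith [hret_pos k]
  set Tper : ℝ := ∑ j ∈ Finset.range M, pkg.ret (x j) with hTper_def
  have hTM : ∀ k, T (k + M) = T k + Tper := fun k => by
    simp only [hT_def, hTper_def]
    rw [add_comm k M, Finset.sum_range_add]
    simp only [show ∀ j : ℕ, M + j = j + M from fun j => add_comm _ _, hxM]
    ring
  have hTM' : T M = T 0 + Tper := by have := hTM 0; rwa [zero_add] at this
  have hTperQ : Q₀ ≤ Tper := by
    refine hmP.trans ?_
    have hsplit : Tper = ∑ j ∈ Finset.range (2 * Nc + 1), pkg.ret (x j) +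
        ∑ i ∈ Finset.range m, pkg.ret (x ((2 * Nc + 1 + i : ℕ) : ℤ)) := by
      rw [hTper_def, hM_def, Finset.sum_range_add]
    have h1 : 0 ≤ ∑ j ∈ Finset.range (2 * Nc + 1), pkg.ret (x j) :=
      Finset.sum_nonneg fun j _ => (hret_pos j).le
    have h2 : ∑ i ∈ Finset.range m, P₀ / 2 ≤ ∑ i ∈ Finset.range m, pkg.ret (x ((2 * Nc + 1 + i : ℕ) : ℤ)) :=
      Finset.sum_le_sum fun i hi => by
        have h := abs_le.1 (hret_near (2 * Nc + 1 + i) pkg.p₀ hp₀S (hdw' i (Finset.mem_range.1 hi)))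
        linarith [h.1, min_le_right r P₀]
    simp only [Finset.sum_const, Finset.card_range, nsmul_eq_mul] at h2
    linarith
  have hTper_pos : 0 < Tper := lt_of_lt_of_le (by positivity) hTperQ
  have hTtop : Tendsto T atTop atTop := tendsto_atTop_of_add_period hTmono.monotone hTper_pos hTM
  have hdrift_exc : ∀ k : ℕ, k ≤ 2 * Nc + 1 → |T k - pkg.tq ((k : ℤ) - Nc)| ≤ E := fun k hk => by
    rw [show (k : ℤ) - Nc = -(Nc : ℤ) + k by ring, eq_add_sum_of_succ_eq_add pkg.tq_succ]
    simp only [hT_def, add_sub_add_left_eq_sub]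
    refine abs_sum_sub_sum_le_of_norm_sub_le_two_sided hL (fun j => hxS j) (fun j => hqS _)
      (by positivity) hθ.le hθ1 (n := 2 * Nc) (fun j hj => ?_) hk
    rw [show -(Nc : ℤ) + j = (j : ℤ) - Nc by ring]
    exact hexc j hj
  have hdrift_dw : ∀ i : ℕ, i ≤ m → |T (2 * Nc + 1 + i) - T (2 * Nc + 1) - i * P₀| ≤ E := fun i hi => by
    rw [show T (2 * Nc + 1 + i) - T (2 * Nc + 1) =
      ∑ j ∈ Finset.range i, pkg.ret (x ((2 * Nc + 1 + j : ℕ) : ℤ)) by simp only [hT_def, Finset.sum_range_add]; ring]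
    exact abs_sum_sub_mul_le_of_norm_sub_le_two_sided hL (fun j => hxS _) hp₀S (by positivity) hθ.le hθ1 hdw hi
  have hT2N : |T (2 * Nc + 1) - pkg.tq ((Nc : ℤ) + 1)| ≤ E := by
    have := hdrift_exc (2 * Nc + 1) le_rfl
    rwa [show ((2 * Nc + 1 : ℕ) : ℤ) - Nc = (Nc : ℤ) + 1 by push_cast; ring] at this
  /- §6 gluing: local pieces `sol (x k)` along the schedule, closed up by periodicity -/
  have hsolk : ∀ k : ℕ, IsClassicalNSSolutionOn (Ioc 0 (pkg.ret (x k) + r)) ν (fun _ => F)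
      (pkg.sol (x k)) (pkg.pres (x k)) := fun k => pkg.sol_isSolution _ (hxS k)
  have hseam : ∀ k : ℕ, Tendsto (fun s => ∫ y, ‖pkg.sol (x (k + 1 : ℕ)) s y - pkg.sol (x k) (pkg.ret (x k)) y‖ ^ 2)
      (𝓝[>] 0) (𝓝 0) := fun k => by
    rw [show pkg.sol (x k) (pkg.ret (x k)) = pkg.chart (x (k + 1 : ℕ)) by
      rw [pkg.sol_ret _ (hxS k), hx k, Nat.cast_succ]]
    exact pkg.sol_tendsto_zero _ (hxS _)
  obtain ⟨uc, pc, hsolc, huc, hpc⟩ := IsClassicalNSSolutionOn.concat_schedule hν.le hret_pos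
    (fun _ => hr) hT_succ hTtop hsolk hseam (0 : 𝕋³)
  obtain ⟨hucP, hpcP⟩ := IsClassicalNSSolutionOn.concat_schedule_periodic hTmono hTtop hTM
    (w := fun k => pkg.sol (x k)) (π := fun k => pkg.pres (x k)) (fun k => by simp only [hxM])
    (fun k => by simp only [hxM]) (0 : 𝕋³) huc hpc
  obtain ⟨U, Pr, hU, hUper, -, hUu, -⟩ := hsolc.periodic_extension hTper_pos (fun _ => rfl) hucP hpcP
  /- §7 the train: `d := Tper − ℓ` -/
  have habs1 := abs_le.1 (le_refl |pkg.tq (-(Nc : ℤ))|)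
  have habs2 := abs_le.1 (le_refl |pkg.tq ((Nc : ℤ) + 1)|)
  refine ⟨Tper - ℓ, by linarith, U, Pr, hU, by rw [show ℓ + (Tper - ℓ) = Tper by ring]; exact hUper, ?_⟩
  /- §8 equal-time closeness: smoothness, and the two comparison patterns -/
  obtain ⟨pΓ, hΓ⟩ := hloop.excursion
  obtain ⟨pP, hPsol⟩ := hloop.base
  have hsmΓ : ∀ t, IsSmooth (uΓ t) := fun t => hΓ.smooth_velocity.isSmooth_slice (mem_univ t)
  have hsmP : ∀ t, IsSmooth (uP t) := fun t => hPsol.smooth_velocity.isSmooth_slice (mem_univ t)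
  have hsmsol : ∀ (k : ℕ), ∀ τ ∈ Ioc 0 (pkg.ret (x k)), IsSmooth (pkg.sol (x k) τ) := fun k τ hτ =>
    (hsolk k).smooth_velocity.isSmooth_slice ⟨hτ.1, hτ.2.trans (by linarith)⟩
  have comm : ∀ v w : 𝕋³ → ℝ³, h1DistSq v w = h1DistSq w v := fun v w => Torus.h1DistSq_comm v w
  have two : ∀ {a b c : 𝕋³ → ℝ³}, IsSmooth a → IsSmooth b → IsSmooth c →
      h1DistSq a c ≤ 2 * h1DistSq a b + 2 * h1DistSq b c := fun ha hb hc => Torus.h1DistSq_le_two_mul ha hb hc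
  have three : ∀ {a b₁ b₂ c : 𝕋³ → ℝ³}, IsSmooth a → IsSmooth b₁ → IsSmooth b₂ → IsSmooth c →
      h1DistSq a c ≤ 2 * h1DistSq a b₁ + 4 * h1DistSq b₁ b₂ + 4 * h1DistSq b₂ c :=
    fun ha hb₁ hb₂ hc => Torus.h1DistSq_le_three_points ha hb₁ hb₂ hc
  -- continuous dependence at a shadowing point: `sol (x k) τ` vs `sol s τ`, `s` a loop point
  have hdep : ∀ (k : ℕ) (s : Sec), s ∈ S → ‖x k - s‖ ≤ 2 * C * ε → ∀ τ ∈ Ioc 0 (pkg.ret (x k)),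
      τ ∈ Ioc 0 (pkg.ret s + r) ∧ h1DistSq (pkg.sol (x k) τ) (pkg.sol s τ) ≤ K * (2 * C * ε) ^ 2 := by
    intro k s hs hdev τ hτ
    have hτ' : τ ∈ Ioc 0 (pkg.ret s + r) :=
      ⟨hτ.1, by linarith [hτ.2, (abs_le.1 (hret_near k s hs hdev)).2, min_le_left r P₀]⟩
    refine ⟨hτ', ?_⟩
    rw [comm]
    refine (hK _ hs _ (mem_ball.2 ?_) τ hτ').trans (mul_le_mul_of_nonneg_left ?_ hK0)
    · rw [dist_eq_norm]; linarith
    · rw [norm_sub_rev]; exact pow_le_pow_left₀ (norm_nonneg _) hdev 2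
  -- (a) along the excursion: through `sol (q (k − N)) τ = u_Γ (tq (k − N) + τ)`
  have hexc_close : ∀ k : ℕ, k ≤ 2 * Nc → ∀ τ ∈ Ioc 0 (pkg.ret (x k)),
      h1DistSq (pkg.sol (x k) τ) (uΓ (T k + τ)) ≤ δ ^ 2 := fun k hk τ hτ => by
    set n : ℤ := (k : ℤ) - Nc with hn
    obtain ⟨hτ', h1⟩ := hdep k (pkg.q n) (hqS n) ((hexc k hk).trans (hCε2 _ _)) τ hτ
    have h2 : pkg.sol (pkg.q n) τ = uΓ (pkg.tq n + τ) := pkg.sol_q n τ ⟨hτ'.1.le, hτ'.2⟩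
    have h3 : h1DistSq (uΓ (pkg.tq n + τ)) (uΓ (T k + τ)) ≤ Kt * E ^ 2 := by
      refine ((hKt _ _).1).trans (mul_le_mul_of_nonneg_left ?_ hKt0)
      rw [show pkg.tq n + τ - (T k + τ) = -(T k - pkg.tq n) by ring, neg_sq]
      exact sq_le_sq' (abs_le.1 (hdrift_exc k (by omega))).1 (abs_le.1 (hdrift_exc k (by omega))).2
    have hsm2 : IsSmooth (pkg.sol (pkg.q n) τ) := by rw [h2]; exact hsmΓ _
    have := two (hsmsol k τ hτ) hsm2 (hsmΓ (T k + τ))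
    rw [h2] at h1 this
    linarith only [this, h1, h3, hKε, hKtE, sq_nonneg δ]
  -- (b) near the base: through `u_P`, with an integer phase `j P₀`
  set Φ : ℝ := 2 * E + 2 * B + (L : ℝ) * Q with hΦ_def
  have htail_close : ∀ k : ℕ, 2 * Nc + 1 ≤ k → k < M → ∀ τ ∈ Ioc 0 (pkg.ret (x k)), ∀ n' : ℤ,
      ‖pkg.q n' - pkg.p₀‖ ≤ Q → ∀ τ' ∈ Ioc 0 (pkg.ret (pkg.q n')), ∀ j : ℤ, |τ - τ' - j * P₀| ≤ Φ →
        h1DistSq (pkg.sol (x k) τ) (uΓ (pkg.tq n' + τ')) ≤ δ ^ 2 := by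
    intro k hk hkM τ hτ n' hn' τ' hτ' j hj
    obtain ⟨i, rfl⟩ : ∃ i : ℕ, k = 2 * Nc + 1 + i := ⟨k - (2 * Nc + 1), by omega⟩
    obtain ⟨hτP, a1⟩ := hdep _ pkg.p₀ hp₀S (hdw' i (by omega)) τ hτ
    have hretn' : |pkg.ret (pkg.q n') - P₀| ≤ L * ‖pkg.q n' - pkg.p₀‖ := by
      have h := hL.dist_le_mul _ (hqS n') _ hp₀S; rwa [Real.dist_eq, dist_eq_norm] at h
    have hretn := abs_le.1 hretn'
    have hLn : (L : ℝ) * ‖pkg.q n' - pkg.p₀‖ ≤ min r P₀ / 4 := (mul_le_mul_of_nonneg_left hn' hL0).trans hLQ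
    have hτ'P : τ' ∈ Ioc 0 (pkg.ret pkg.p₀ + r) :=
      ⟨hτ'.1, by simp only [P₀] at hretn; linarith [hτ'.2, hretn.2, min_le_left r P₀]⟩
    rw [pkg.sol_p₀ τ ⟨hτP.1.le, hτP.2⟩] at a1
    have a2 : h1DistSq (uP τ) (uP (τ' + j * P₀)) ≤ Kt * Φ ^ 2 := by
      refine ((hKt _ _).2).trans (mul_le_mul_of_nonneg_left ?_ hKt0)
      rw [show τ - (τ' + j * P₀) = τ - τ' - j * P₀ by ring]
      exact sq_le_sq' (abs_le.1 hj).1 (abs_le.1 hj).2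
    have a3 : uP (τ' + j * P₀) = uP τ' := (pkg.base_periodic.int_mul j) τ'
    have a4 : h1DistSq (uP τ') (uΓ (pkg.tq n' + τ')) ≤ K * Q ^ 2 := by
      rw [← pkg.sol_p₀ τ' ⟨hτ'P.1.le, hτ'P.2⟩, ← pkg.sol_q n' τ' ⟨hτ'.1.le, by linarith [hτ'.2]⟩]
      refine (hK _ hp₀S _ (mem_ball.2 ?_) τ' hτ'P).trans (mul_le_mul_of_nonneg_left ?_ hK0)
      · rw [dist_eq_norm]; linarith
      · rw [norm_sub_rev]; exact pow_le_pow_left₀ (norm_nonneg _) hn' 2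
    have key := three (hsmsol _ τ hτ) (hsmP τ) (hsmP (τ' + j * P₀)) (hsmΓ (pkg.tq n' + τ'))
    rw [a3] at key a2
    have hΦ2 : Φ ^ 2 ≤ 12 * E ^ 2 + 12 * B ^ 2 + 3 * ((L : ℝ) * Q) ^ 2 := by
      have hid : 12 * E ^ 2 + 12 * B ^ 2 + 3 * ((L : ℝ) * Q) ^ 2 - Φ ^ 2 =
          (2 * E - 2 * B) ^ 2 + (2 * B - L * Q) ^ 2 + (2 * E - L * Q) ^ 2 := by rw [hΦ_def]; ring
      linarith only [hid, sq_nonneg (2 * E - 2 * B), sq_nonneg (2 * B - L * Q), sq_nonneg (2 * E - L * Q)]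
    have hθk2 : θ ^ (Nc - n₀) * θ ^ (Nc - n₀) ≤ θ ^ (Nc - n₀) :=
      mul_le_of_le_one_left (pow_nonneg hθ.le _) (hθle1 _)
    have hB2 : Kt * B ^ 2 ≤ δ ^ 2 / 256 :=
      calc Kt * B ^ 2 = Kt * ((L : ℝ) * Cq / (1 - θ)) ^ 2 * (θ ^ (Nc - n₀) * θ ^ (Nc - n₀)) := by
            rw [hB_def]; ring
        _ ≤ Kt * ((L : ℝ) * Cq / (1 - θ)) ^ 2 * θ ^ (Nc - n₀) :=
            mul_le_mul_of_nonneg_left hθk2 (mul_nonneg hKt0 (sq_nonneg _))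
        _ ≤ δ ^ 2 / 256 := hKtB
    have hQ2 : K * Q ^ 2 ≤ δ ^ 2 / 16 :=
      calc K * Q ^ 2 = K * Cq ^ 2 * (θ ^ (Nc - n₀) * θ ^ (Nc - n₀)) := by rw [hQ_def]; ring
        _ ≤ K * Cq ^ 2 * θ ^ (Nc - n₀) := mul_le_mul_of_nonneg_left hθk2 (mul_nonneg hK0 (sq_nonneg _))
        _ ≤ δ ^ 2 / 16 := hKQ
    have hLQ2 : Kt * ((L : ℝ) * Q) ^ 2 ≤ δ ^ 2 / 256 := by
      have h1 : (L : ℝ) * Q ≤ B := by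
        rw [hB_def, hQ_def]
        exact mul_le_mul_of_nonneg_left (mul_le_mul_of_nonneg_left
          (le_div_self (pow_nonneg hθ.le _) hθ' (by linarith)) hCq) hL0
      exact le_trans (mul_le_mul_of_nonneg_left (pow_le_pow_left₀ (by positivity) h1 2) hKt0) hB2
    have hKtΦ : Kt * Φ ^ 2 ≤ Kt * (12 * E ^ 2 + 12 * B ^ 2 + 3 * ((L : ℝ) * Q) ^ 2) :=
      mul_le_mul_of_nonneg_left hΦ2 hKt0
    linarith only [key, a1, a2, a4, hKε, hKtE, hB2, hQ2, hLQ2, hKtΦ, sq_nonneg δ]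
  /- §9 the window `[−d/2, ℓ + d/2]` -/
  intro t ht
  rcases lt_or_ge (T 0) t with h0t | ht0
  · -- (A) inside the concatenation window `(T 0, T M]`
    have htM : t ≤ T M := by rw [hTM', hT0]; linarith [ht.2, hTperQ, habs1.1]
    obtain ⟨k, -, hkM, hk⟩ := exists_mem_Ioc_of_mem_Ioc_of_strictMono hTmono ⟨h0t, htM⟩
    have hτ : t - T k ∈ Ioc 0 (pkg.ret (x k)) := ⟨by linarith [hk.1], by linarith [hk.2, hT_succ k]⟩
    rw [show U t = pkg.sol (x k) (t - T k) by rw [hUu t h0t, huc k t hk]]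
    rcases le_or_gt k (2 * Nc) with hk2 | hk2
    · have := hexc_close k hk2 (t - T k) hτ
      rwa [show T k + (t - T k) = t by ring] at this
    · -- dwell: `u_Γ` is in its forward tail
      obtain ⟨n', hn'⟩ := exists_mem_Ioc_of_strictMono_int pkg.tq_strictMono pkg.tq_top pkg.tq_bot t
      have hretNc := abs_le.1 hretq
      have htq : pkg.tq ((Nc : ℤ) + 1) = pkg.tq Nc + pkg.ret (pkg.q Nc) := pkg.tq_succ Nc
      have htNc : pkg.tq (Nc : ℤ) < t := by
        have h1 : T (2 * Nc + 1) ≤ T k := hTmono.monotone (by omega)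
        linarith [hk.1, min_le_right r P₀, hLQ, hretNc.1, hEc, (abs_le.1 hT2N).1]
      have hNcn' : (Nc : ℤ) ≤ n' := by
        have : (Nc : ℤ) < n' + 1 := pkg.tq_strictMono.lt_iff_lt.1 (htNc.trans_le hn'.2)
        omega
      obtain ⟨n, rfl⟩ : ∃ n : ℕ, n' = (Nc : ℤ) + n := ⟨(n' - Nc).toNat, by omega⟩
      have hqn' : ‖pkg.q ((Nc : ℤ) + n) - pkg.p₀‖ ≤ Q :=
        (hqfw n).trans (mul_le_mul_of_nonneg_left (hθpow (by omega)) hCq)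
      have hτ' : t - pkg.tq ((Nc : ℤ) + n) ∈ Ioc 0 (pkg.ret (pkg.q ((Nc : ℤ) + n))) :=
        ⟨by linarith [hn'.1], by linarith [hn'.2, pkg.tq_succ ((Nc : ℤ) + n)]⟩
      obtain ⟨i, rfl⟩ : ∃ i : ℕ, k = 2 * Nc + 1 + i := ⟨k - (2 * Nc + 1), by omega⟩
      have hphase : |(t - T (2 * Nc + 1 + i)) - (t - pkg.tq ((Nc : ℤ) + n)) -
          (((n : ℤ) - i - 1 : ℤ) : ℝ) * P₀| ≤ Φ := by
        have e1 := abs_le.1 (hdrift_dw i (by omega))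
        have e2 := abs_le.1 hT2N
        have e4 := abs_le.1 (hdriftfw n)
        have hLQ0 : 0 ≤ (L : ℝ) * Q := by positivity
        rw [abs_le]; push_cast; constructor <;> linarith [hretNc.1, hretNc.2]
      have := htail_close (2 * Nc + 1 + i) (by omega) hkM _ hτ _ hqn' _ hτ' _ hphase
      rwa [show pkg.tq ((Nc : ℤ) + n) + (t - pkg.tq ((Nc : ℤ) + n)) = t by ring] at this
  · -- (B) before the anchor `T 0 = tq (−N)`: the train one period later (dwell) vs the backward tail
    have h0tu : T 0 < t + Tper := by rw [hT0]; linarith [ht.1, hTperQ, habs1.2]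
    have htu2N : T (2 * Nc + 1) < t + Tper := by
      linarith [ht.1, hTperQ, habs2.2, hEc, min_le_right r P₀, (abs_le.1 hT2N).2]
    obtain ⟨k, hk2, hkM, hk⟩ := exists_mem_Ioc_of_mem_Ioc_of_strictMono hTmono
      ⟨htu2N, show t + Tper ≤ T M by rw [hTM']; linarith⟩
    have hτ : t + Tper - T k ∈ Ioc 0 (pkg.ret (x k)) := ⟨by linarith [hk.1], by linarith [hk.2, hT_succ k]⟩
    obtain ⟨n', hn'⟩ := exists_mem_Ioc_of_strictMono_int pkg.tq_strictMono pkg.tq_top pkg.tq_bot t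
    have hn'Nc : n' < -(Nc : ℤ) := pkg.tq_strictMono.lt_iff_lt.1 (hn'.1.trans_le (by rwa [hT0] at ht0))
    obtain ⟨n, rfl⟩ : ∃ n : ℕ, n' = -(Nc : ℤ) - 1 - n := ⟨(-(Nc : ℤ) - 1 - n').toNat, by omega⟩
    have hqn' : ‖pkg.q (-(Nc : ℤ) - 1 - n) - pkg.p₀‖ ≤ Q :=
      (hqbw n).trans (mul_le_mul_of_nonneg_left (hθpow (by omega)) hCq)
    have hτ' : t - pkg.tq (-(Nc : ℤ) - 1 - n) ∈ Ioc 0 (pkg.ret (pkg.q (-(Nc : ℤ) - 1 - n))) :=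
      ⟨by linarith [hn'.1], by linarith [hn'.2, pkg.tq_succ (-(Nc : ℤ) - 1 - n)]⟩
    obtain ⟨i, rfl⟩ : ∃ i : ℕ, k = 2 * Nc + 1 + i := ⟨k - (2 * Nc + 1), by omega⟩
    rw [show U t = pkg.sol (x ((2 * Nc + 1 + i : ℕ) : ℤ)) (t + Tper - T (2 * Nc + 1 + i)) by
      rw [← hUper t, hUu _ h0tu, huc _ _ hk]]
    have hphase : |(t + Tper - T (2 * Nc + 1 + i)) - (t - pkg.tq (-(Nc : ℤ) - 1 - n)) -
        (((m : ℤ) - i - (n + 1) : ℤ) : ℝ) * P₀| ≤ Φ := by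
      have e1 := abs_le.1 (hdrift_dw i (by omega))
      have e0 := hdrift_dw m le_rfl; rw [← hM_def] at e0; have e0' := abs_le.1 e0
      have e4 := hdriftbw (n + 1)
      rw [show (-(Nc : ℤ) - ((n + 1 : ℕ) : ℤ)) = -(Nc : ℤ) - 1 - n by push_cast; ring] at e4
      have e4' := abs_le.1 e4; push_cast at e4'
      have hLQ0 : 0 ≤ (L : ℝ) * Q := by positivity
      rw [abs_le, show Tper = T M - T 0 by linarith, hT0]; push_cast; constructor <;> linarith
    have := htail_close (2 * Nc + 1 + i) (by omega) hkM _ hτ _ hqn' _ hτ' _ hphase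
    rwa [show pkg.tq (-(Nc : ℤ) - 1 - n) + (t - pkg.tq (-(Nc : ℤ) - 1 - n)) = t by ring] at this

end Summit.AnomalousDissipation.AnomalousDissipation.Theorems.DenseLoudDesignerForces.Homoclinic

end
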